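import Literature.NumberTheory.EllipticCurves.HeegnerGeomShiftPinningProofs
import HarnessLib

/-!
# The point identities (P1) `v_j = u_{j−1}` and (P2) `Norm_{K_j/K_{j−1}} u_j = a_p u_{j−1} − v_{j−1}` of the
# coherent `d(k)`-shifted Heegner datum (CGLS 2022 Rem. 4.1.4; Howard 2004 §3.3; Perrin-Riou 1987 §3.3)
# — THEOREMS ONLY

Topic `NumberTheory/EllipticCurves`; namespace `Literature.NumberTheory.EllipticCurves`. No definition, no
named fact. Cell `pub/bsd-print-x9`, LEAD `bsd-line-x9-p1` (envelope infrastructure, part VI-b: the hand-over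
to the Kummer/`Λ`-adic consumer of the envelope stub of the line `torsion-depth-pinned`).

For the coherent CGLS datum of `exists_stabilizedHeegnerData_of_system` — `u_k = Σ_{a ∈ A_k} a • x_{d(k)}`,
`v_k = Σ_{a ∈ A_k} a • x_{d(k)−1}` over ONE principal system `x_c` of Heegner points of conductors `p^c` and
transversals `A_k` of `Gal(K̄/K[p^{d(k)}])` in `Gal(K̄/K_k)` — with the shift PINNED (`d(k+1) = d(k) + 1` above
the depth, `HeegnerGeomShiftPinningProofs`, under `K_k ⊆ K[p^{k+1}]`, `K[p^∞] ⊆ K_∞K[p]`, `[K[p] : K[1]] = p−1`):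

* (P1) `StabilizedHeegnerData.v_eq_u_sub_one_of_presentation`: `v_j = u_{j−1}` for `j > δ + 1` (CGLS Rem.
  4.1.4: `Norm_{K[p^{d(j)}]/K_j} P[p^{d(j)−1}] = Norm_{K[p^{d(j−1)}]/K_{j−1}} P[p^{d(j−1)}]`) — transversal lifting
  through the re-layering `Gal(K̄/K_j) ⊓ Gal(K̄/K[p^{d−1}]) = Gal(K̄/K[p^d])`;
* (P2) `StabilizedHeegnerData.sum_topGenerator_pow_smul_u_eq_of_presentation`:
  `Σ_{i<p} γ^{p^{j−1} i} • u_j = a_p • u_{j−1} − v_{j−1}` for `j > δ + 1`, `γ` a topological generator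
  (`{γ^{p^{j−1} i}}_{i<p}` is a transversal of `Gal(K̄/K_j)` in `Gal(K̄/K_{j−1})`:
  `ZpExtension.existsUnique_topGenerator_pow`) — the vertical distribution relation
  `Tr_{K[p^{d+1}]/K[p^d]} P[p^{d+1}] = a_p P[p^d] − P[p^{d−1}]` (tree) composed with
  `Norm_{K[p^{d+1}]/K_{j−1}} = Norm_{K_j/K_{j−1}} ∘ Norm_{K[p^{d+1}]/K_j}`.

These are the `n = 0` (printed) cases of the generalised identities of `HeegnerGeomLayerDescentProofs` (x9-p1-w2),
which need no pin.

## References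

* [CastellaGrossiLeeSkinner2022] F. Castella, G. Grossi, J. Lee, C. Skinner, *On the anticyclotomic Iwasawa
  theory of rational elliptic curves at Eisenstein primes*, Invent. Math. 227 (2022), Thm. 4.1.1 (proof:
  `d(k)`, `P_k[n]`) and Rem. 4.1.4 (arXiv:2008.02571v2, p. 22).
* [Howard2004HeegnerKolyvagin] B. Howard, *The Heegner point Kolyvagin system*, Compos. Math. 140 (2004), §3.3.
* [PerrinRiou1987BSMF] B. Perrin-Riou, *Fonctions L p-adiques, théorie d'Iwasawa et points de Heegner*,
  Bull. SMF 115 (1987), §1 (the tower `K_∞ ⊂ ∪ K[p^n]`), §3.3 (relations de distribution).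
* [Cox2013] D. A. Cox, *Primes of the form x² + ny²*, 2nd ed. (2013), Thm. 7.24, Cor. 7.28.
-/

set_option autoImplicit false

noncomputable section

open scoped Classical

namespace Literature.NumberTheory.EllipticCurves

open WeierstrassCurve RingClassField ModularForms

variable {K : Type} [Field K] [NumberField K] {p : ℕ} [Fact p.Prime]

/-! ### §1 Transversal bookkeeping along the anticyclotomic tower -/

section Transversal

variable {Γ : Type*} [Group Γ]

/-- **Lifting a transversal one step**: if `A ⊆ L'` is a transversal of `H'` in `L'`, `H' ≤ H`, `L' ⊓ H ≤ H'`,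
and every `τ ∈ L` differs from an element of `L'` by an element of `H` (`τ g⁻¹ ∈ L'`, `g ∈ H`), then `A` is
also a transversal of `H` in `L` (the shape `∀ τ ∈ L, ∃! a ∈ A, a⁻¹τ ∈ H` of `IsHeegnerNormPoint`). Pure group
theory — the re-layering `K_k · K[p^{d−1}] = K[p^d]` read on transversals. [folklore] -/
private theorem existsUnique_transversal_of_step {L L' H H' : Subgroup Γ} {A : Finset Γ}
    (hA : ∀ a ∈ A, a ∈ L') (htA : ∀ τ ∈ L', ∃! a, a ∈ A ∧ a⁻¹ * τ ∈ H') (hH : H' ≤ H)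
    (hinf : ∀ g, g ∈ L' → g ∈ H → g ∈ H') (hgen : ∀ τ ∈ L, ∃ g ∈ H, τ * g⁻¹ ∈ L') :
    ∀ τ ∈ L, ∃! a, a ∈ A ∧ a⁻¹ * τ ∈ H := by
  intro τ hτ
  obtain ⟨g, hg, hτg⟩ := hgen τ hτ
  obtain ⟨a, ⟨haA, ha⟩, huniq⟩ := htA (τ * g⁻¹) hτg
  refine ⟨a, ⟨haA, ?_⟩, ?_⟩
  · have : a⁻¹ * τ = (a⁻¹ * (τ * g⁻¹)) * g := by group
    rw [this]
    exact H.mul_mem (hH ha) hg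
  · rintro b ⟨hbA, hb⟩
    refine huniq b ⟨hbA, hinf _ ?_ ?_⟩
    · exact L'.mul_mem (L'.inv_mem (hA b hbA)) hτg
    · have : b⁻¹ * (τ * g⁻¹) = (b⁻¹ * τ) * g⁻¹ := by group
      rw [this]
      exact H.mul_mem hb (H.inv_mem hg)

end Transversal

namespace ZpExtension

variable (κ : ZpExtension K p)

omit [NumberField K] in
/-- **`Gal(K_i/K_{i+1})` is generated by any element of exact level `i`**: for `g₀ ∈ Gal(K̄/K_i) ∖ Gal(K̄/K_{i+1})`
and `τ ∈ Gal(K̄/K_i)` there is `n` with `τ g₀^{-n} ∈ Gal(K̄/K_{i+1})` (`κ(g₀) = p^i·unit`, solve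
`κ(τ) ≡ n κ(g₀) (mod p^{i+1})`). [cite: Washington1997, §13.1 (Gal(K_{n+1}/K_n) ≅ ℤ/p)] -/
theorem exists_mul_pow_inv_mem_layerSubgroup_succ {i : ℕ} {g₀ τ : Field.absoluteGaloisGroup K}
    (hg₀ : g₀ ∈ κ.layerSubgroup i) (hg₀n : g₀ ∉ κ.layerSubgroup (i + 1)) (hτ : τ ∈ κ.layerSubgroup i) :
    ∃ n : ℕ, τ * (g₀ ^ n)⁻¹ ∈ κ.layerSubgroup (i + 1) := by
  rw [mem_layerSubgroup] at hg₀ hτ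
  obtain ⟨w, hw⟩ := hg₀
  obtain ⟨t, ht⟩ := hτ
  have hwunit : IsUnit w := by
    by_contra hwn
    apply hg₀n
    rw [mem_layerSubgroup, hw, pow_succ]
    exact mul_dvd_mul_left _ ((PadicInt.norm_lt_one_iff_dvd w).mp (PadicInt.not_isUnit_iff.mp hwn))
  obtain ⟨wi, hwi⟩ := hwunit.exists_right_inv
  set n : ℕ := (wi * t).zmodRepr with hn
  have hr := PadicInt.sub_zmodRepr_mem (wi * t)
  rw [PadicInt.maximalIdeal_eq_span_p, Ideal.mem_span_singleton] at hr
  obtain ⟨r, hr⟩ := hr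
  refine ⟨n, ?_⟩
  rw [mem_layerSubgroup, map_mul, map_inv, map_pow, toAdd_mul, toAdd_inv, toAdd_pow, ht, hw, pow_succ]
  refine ⟨w * r, ?_⟩
  rw [nsmul_eq_mul]
  linear_combination ((p : ℤ_[p]) ^ i * w) * hr - ((p : ℤ_[p]) ^ i * t) * hwi

omit [NumberField K] in
/-- `γ^{p^m i} ∈ Gal(K̄/K_m)` for a topological generator `γ` (`κ(γ^{p^m i}) = p^m i`).
[cite: Washington1997, §13.1 (Gal(K_∞/K_n) = p^n ℤ_p topologically generated by γ^{p^n})] -/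
theorem topGenerator_pow_mem_layerSubgroup {γ : Field.absoluteGaloisGroup K} (hγ : κ.IsTopGenerator γ)
    (m i : ℕ) : γ ^ (p ^ m * i) ∈ κ.layerSubgroup m := by
  rw [mem_layerSubgroup, map_pow, toAdd_pow, hγ, toAdd_ofAdd, nsmul_eq_mul, mul_one, Nat.cast_mul,
    Nat.cast_pow]
  exact Dvd.intro _ rfl

omit [NumberField K] in
/-- `i ↦ γ^{p^m i}` is injective on `{0, …, p−1}` (indeed on `ℕ`: `κ(γ^{p^m i}) = p^m i` in the domain `ℤ_p`).
[cite: Washington1997, §13.1 (Gal(K_{n+1}/K_n) ≅ ℤ/p generated by γ^{p^n})] -/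
theorem topGenerator_pow_injOn {γ : Field.absoluteGaloisGroup K} (hγ : κ.IsTopGenerator γ) (m : ℕ) :
    Set.InjOn (fun i : ℕ ↦ γ ^ (p ^ m * i)) ↑(Finset.range p) := by
  have hp : p.Prime := Fact.out
  intro i _ i' _ h
  have h' := congrArg (fun g ↦ (κ g).toAdd) h
  simp only [map_pow, toAdd_pow, nsmul_eq_mul, Nat.cast_mul, Nat.cast_pow] at h'
  have h1 : Multiplicative.toAdd (κ γ) = 1 := by rw [hγ]; rfl
  rw [h1, mul_one, mul_one] at h'
  have hp0 : (p : ℤ_[p]) ^ m ≠ 0 := pow_ne_zero _ (by exact_mod_cast hp.ne_zero)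
  exact_mod_cast mul_left_cancel₀ hp0 h'

omit [NumberField K] in
/-- **`{γ^{p^m i} : i < p}` is a transversal of `Gal(K̄/K_{m+1})` in `Gal(K̄/K_m)`** (`Gal(K_{m+1}/K_m) =
⟨γ^{p^m}⟩ ≅ ℤ/p`; the enumeration of `LambdaAdicSelmerData.proj_norm`).
[cite: Washington1997, §13.1 (Gal(K_{n+1}/K_n) ≅ ℤ/p generated by γ^{p^n})] -/
theorem existsUnique_topGenerator_pow {γ : Field.absoluteGaloisGroup K} (hγ : κ.IsTopGenerator γ) (m : ℕ) :
    ∀ τ ∈ κ.layerSubgroup m, ∃! a, a ∈ (Finset.range p).image (fun i : ℕ ↦ γ ^ (p ^ m * i)) ∧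
      a⁻¹ * τ ∈ κ.layerSubgroup (m + 1) := by
  have hp : p.Prime := Fact.out
  intro τ hτ
  rw [mem_layerSubgroup] at hτ
  obtain ⟨t, ht⟩ := hτ
  -- membership criterion for `(γ^{p^m i})⁻¹ τ`
  have hcrit : ∀ i : ℕ, (γ ^ (p ^ m * i))⁻¹ * τ ∈ κ.layerSubgroup (m + 1) ↔ (p : ℤ_[p]) ∣ t - i := by
    intro i
    rw [mem_layerSubgroup, map_mul, map_inv, map_pow, toAdd_mul, toAdd_inv, toAdd_pow, hγ, toAdd_ofAdd, ht,
      nsmul_eq_mul, mul_one, Nat.cast_mul, Nat.cast_pow, pow_succ,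
      show -((p : ℤ_[p]) ^ m * (i : ℤ_[p])) + (p : ℤ_[p]) ^ m * t = (p : ℤ_[p]) ^ m * (t - i) by ring]
    exact mul_dvd_mul_iff_left (pow_ne_zero _ (by exact_mod_cast hp.ne_zero))
  have hcrit' : ∀ i : ℕ, (p : ℤ_[p]) ∣ t - i ↔ t - i ∈ IsLocalRing.maximalIdeal ℤ_[p] := fun i ↦ by
    rw [PadicInt.maximalIdeal_eq_span_p, Ideal.mem_span_singleton]
  refine ⟨γ ^ (p ^ m * t.zmodRepr), ⟨Finset.mem_image.mpr ⟨t.zmodRepr, Finset.mem_range.mpr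
    (PadicInt.zmodRepr_lt_p t), rfl⟩, (hcrit _).mpr ((hcrit' _).mpr (PadicInt.sub_zmodRepr_mem t))⟩, ?_⟩
  rintro a ⟨ha, haτ⟩
  obtain ⟨i, hi, rfl⟩ := Finset.mem_image.mp ha
  have hi' : t.zmodRepr = i :=
    PadicInt.zmodRepr_unique t i (Finset.mem_range.mp hi) ((hcrit' i).mp ((hcrit i).mp haτ))
  rw [hi']

end ZpExtension

/-! ### §2 The point identities (P1), (P2) of the coherent CGLS datum -/

namespace CastellaGrossiLeeSkinner2022.StabilizedHeegnerData

variable {N : ℕ} [NeZero N] {W : WeierstrassCurve ℚ} {κ : ZpExtension K p} {jbar : AlgebraicClosure K →+* ℂ}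

/-- **(P1) `v_j = u_{j−1}` for `j > δ + 1`** (CGLS 2022 Rem. 4.1.4: `P[p^{d(j)}]_α = P[p^{d(j)}] − α⁻¹P[p^{d(j)−1}]`
with `Norm_{K[p^{d(j)}]/K_j} P[p^{d(j)−1}] = Norm_{K[p^{d(j−1)}]/K_{j−1}} P[p^{d(j−1)}]`, `d(j) = d(j−1) + 1`): for a
`d(k)`-shifted datum whose `u_k`, `v_k` are the transversal sums `Σ_{a ∈ A_k} a • x_{d(k)}`, `Σ_{a ∈ A_k} a • x_{d(k)−1}`
of ONE system of points `x_c` fixed by `Gal(K̄/K[p^c])` over transversals `A_k` of `Gal(K̄/K[p^{d(k)}])` in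
`Gal(K̄/K_k)` (the output of `exists_stabilizedHeegnerData_of_system`), under the pinned tower.
[cite: CastellaGrossiLeeSkinner2022, Rem. 4.1.4 (norm-compatibility of α^{-k}P[p^k]_α, arXiv:2008.02571v2 p. 22)]
[cite: Howard2004HeegnerKolyvagin, §3.3] -/
theorem v_eq_u_sub_one_of_presentation (C : StabilizedHeegnerData N W K κ jbar) (hK : IsImaginaryQuadratic K)
    (hTw1 : ∀ k, ringClassSubgroup K (p ^ (k + 1)) jbar ≤ κ.layerSubgroup k)
    (hstep : ∀ j a : ℕ, 1 ≤ j → ringClassSubgroup K (p ^ j) jbar ≤ κ.layerSubgroup a →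
      ringClassSubgroup K (p ^ (j + 1)) jbar ≤ κ.layerSubgroup (a + 1))
    (hcardp : Nat.card (ringClassGalOver (jbar.comp (algebraMap K (AlgebraicClosure K))) p 1) = p - 1)
    {x : ℕ → WeierstrassCurve.geomPoints (W.baseChange K)}
    (hfix : ∀ c, ∀ σ ∈ ringClassSubgroup K (p ^ c) jbar, σ • x c = x c)
    {A : ℕ → Finset (Field.absoluteGaloisGroup K)}
    (hA : ∀ k, (∀ a ∈ A k, a ∈ κ.layerSubgroup k) ∧
      ∀ τ ∈ κ.layerSubgroup k, ∃! a, a ∈ A k ∧ a⁻¹ * τ ∈ ringClassSubgroup K (p ^ C.d k) jbar)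
    (hu : ∀ k, C.u k = ∑ a ∈ A k, a • x (C.d k)) (hv : ∀ k, C.v k = ∑ a ∈ A k, a • x (C.d k - 1))
    {j : ℕ} (hj : C.depth + 1 < j) : C.v j = C.u (j - 1) := by
  have hp : p.Prime := Fact.out
  obtain ⟨i, rfl⟩ : ∃ i, j = i + 1 := ⟨j - 1, by omega⟩
  have hi : C.depth < i := by omega
  have hd : C.d (i + 1) = C.d i + 1 := C.d_succ_eq hK hTw1 hstep hcardp hi
  have hd2 : 2 ≤ C.d i := C.two_le_d hK hcardp hi
  rw [Nat.add_sub_cancel, hv, hu, hd, Nat.add_sub_cancel]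
  refine sum_smul_eq_of_transversal (L := κ.layerSubgroup i) (H := ringClassSubgroup K (p ^ C.d i) jbar)
    (fun a ha ↦ κ.layerSubgroup_antitone (Nat.le_succ i) ((hA (i + 1)).1 a ha)) (hA i).1 ?_ (hA i).2
    (hfix (C.d i))
  -- `A (i+1)` is a transversal of `Gal(K̄/K[p^{d(i)}])` in `Gal(K̄/K_i)`
  have hnot : ¬ ringClassSubgroup K (p ^ C.d i) jbar ≤ κ.layerSubgroup (i + 1) :=
    C.d_min (i + 1) (C.d i) (by omega)
  obtain ⟨g₀, hg₀, hg₀n⟩ := SetLike.not_le_iff_exists.mp hnot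
  have hg₀L : g₀ ∈ κ.layerSubgroup i := C.layer_le i hg₀
  have htA' : ∀ τ ∈ κ.layerSubgroup (i + 1),
      ∃! a, a ∈ A (i + 1) ∧ a⁻¹ * τ ∈ ringClassSubgroup K (p ^ (C.d i + 1)) jbar := by
    have := (hA (i + 1)).2
    rwa [hd] at this
  refine existsUnique_transversal_of_step (hA (i + 1)).1 htA'
    (ringClassSubgroup_anti hK jbar (pow_dvd_pow p (Nat.le_succ _)) (pow_ne_zero _ hp.ne_zero)) ?_ ?_
  · -- `Gal(K̄/K_{i+1}) ⊓ Gal(K̄/K[p^{d(i)}]) = Gal(K̄/K[p^{d(i)+1}])` (re-layering at `i + 1`)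
    intro g hgL hgG
    have hle : ringClassSubgroup K (p ^ (C.d i + 1)) jbar ≤ κ.layerSubgroup (i + 1) := by
      rw [← hd]; exact C.layer_le (i + 1)
    have hrel := inf_ringClassSubgroup_eq_of_not_le hK jbar hp (d := C.d i + 1) (by omega) hle
      (by rw [Nat.add_sub_cancel]; exact hnot)
    rw [Nat.add_sub_cancel] at hrel
    rw [← hrel]
    exact Subgroup.mem_inf.mpr ⟨hgL, hgG⟩
  · intro τ hτ
    obtain ⟨n, hn⟩ := κ.exists_mul_pow_inv_mem_layerSubgroup_succ hg₀L hg₀n hτ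
    exact ⟨g₀ ^ n, pow_mem hg₀ n, hn⟩

/-- **(P2) `Norm_{K_j/K_{j−1}} u_j = a_p · u_{j−1} − v_{j−1}` for `j > δ + 1`**, the norm written on the
transversal `{γ^{p^{j−1} i}}_{i<p}` of `Gal(K̄/K_j)` in `Gal(K̄/K_{j−1})` (`γ` a topological generator):
`Σ_{i<p} γ^{p^{j−1} i} • u_j = a_p • u_{j−1} − v_{j−1}` — the vertical distribution relation
`Tr_{K[p^{d+1}]/K[p^d]} P[p^{d+1}] = a_p P[p^d] − P[p^{d−1}]` (`d = d(j−1) ≥ 2`) read through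
`Norm_{K[p^{d+1}]/K_{j−1}} = Norm_{K_j/K_{j−1}} ∘ Norm_{K[p^{d+1}]/K_j}`, for the coherent datum on a principal
system `x_c` (Howard 2004 §3.3; Perrin-Riou 1987 §3.3; CGLS 2022 Rem. 4.1.4, the norm-compatibility of the
stabilised points). [cite: PerrinRiou1987BSMF, §3.3 (relations de distribution)]
[cite: CastellaGrossiLeeSkinner2022, Rem. 4.1.4 (arXiv:2008.02571v2 p. 22)] [cite: Howard2004HeegnerKolyvagin, §3.3] -/
theorem sum_topGenerator_pow_smul_u_eq_of_presentation [W.IsElliptic] [W.IsGloballyMinimal]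
    [NeZero (W.conductorNorm ℤ)] (C : StabilizedHeegnerData (W.conductorNorm ℤ) W K κ jbar)
    (hK : IsImaginaryQuadratic K) (hH : SatisfiesHeegnerHypothesis (W.conductorNorm ℤ) K)
    (Dt : ModularParametrizationData W (W.conductorNorm ℤ)) {β : ℤ}
    (hβ : (4 * (W.conductorNorm ℤ : ℕ) : ℤ) ∣ β ^ 2 - NumberField.discr K) (hpN : ¬ p ∣ W.conductorNorm ℤ)
    {γ : Field.absoluteGaloisGroup K} (hγ : κ.IsTopGenerator γ)
    (hTw1 : ∀ k, ringClassSubgroup K (p ^ (k + 1)) jbar ≤ κ.layerSubgroup k)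
    (hstep : ∀ j a : ℕ, 1 ≤ j → ringClassSubgroup K (p ^ j) jbar ≤ κ.layerSubgroup a →
      ringClassSubgroup K (p ^ (j + 1)) jbar ≤ κ.layerSubgroup (a + 1))
    (hcardp : Nat.card (ringClassGalOver (jbar.comp (algebraMap K (AlgebraicClosure K))) p 1) = p - 1)
    {x : ℕ → WeierstrassCurve.geomPoints (W.baseChange K)}
    {P : ∀ c : ℕ,
      (W.baseChange (ringClassField K (jbar.comp (algebraMap K (AlgebraicClosure K))) (p ^ c))).toAffine.Point}
    (hx : ∀ c, complexPoint W jbar (x c) = heegnerPointComplexOfConductor Dt (NumberField.discr K) β (p ^ c) ∧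
      WeierstrassCurve.Affine.Point.map (W' := W)
        (ringClassField K (jbar.comp (algebraMap K (AlgebraicClosure K))) (p ^ c)).subtype.toRatAlgHom (P c) =
        heegnerPointComplexOfConductor Dt (NumberField.discr K) β (p ^ c) ∧
      IsHeegnerGeomPoint (W.conductorNorm ℤ) W K Dt β (p ^ c) jbar (x c) ∧
      ∀ σ ∈ ringClassSubgroup K (p ^ c) jbar, σ • x c = x c)
    {A : ℕ → Finset (Field.absoluteGaloisGroup K)}
    (hA : ∀ k, (∀ a ∈ A k, a ∈ κ.layerSubgroup k) ∧
      ∀ τ ∈ κ.layerSubgroup k, ∃! a, a ∈ A k ∧ a⁻¹ * τ ∈ ringClassSubgroup K (p ^ C.d k) jbar)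
    (hu : ∀ k, C.u k = ∑ a ∈ A k, a • x (C.d k)) (hv : ∀ k, C.v k = ∑ a ∈ A k, a • x (C.d k - 1))
    {j : ℕ} (hj : C.depth + 1 < j) :
    ∑ i ∈ Finset.range p, (γ ^ (p ^ (j - 1) * i)) • C.u j = (W.frobeniusTrace p) • C.u (j - 1) - C.v (j - 1) := by
  have hp : p.Prime := Fact.out
  obtain ⟨m, rfl⟩ : ∃ m, j = m + 1 := ⟨j - 1, by omega⟩
  have hm : C.depth < m := by omega
  have hd : C.d (m + 1) = C.d m + 1 := C.d_succ_eq hK hTw1 hstep hcardp hm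
  have hd2 : 2 ≤ C.d m := C.two_le_d hK hcardp hm
  obtain ⟨e, he⟩ : ∃ e, C.d m = e + 1 := ⟨C.d m - 1, by omega⟩
  have hd' : C.d (m + 1) = e + 2 := by omega
  rw [Nat.add_sub_cancel, hu (m + 1), hu m, hv m, hd', he, Nat.add_sub_cancel]
  -- a transversal `R` of `Gal(K̄/K[p^{e+2}])` in `Gal(K̄/K_m)`; both sides are `∑_{r ∈ R} r • x_{e+2}`
  haveI := finiteIndex_ringClassSubgroup K (p ^ (e + 2)) jbar
  obtain ⟨R, hR, htR⟩ :=
    exists_finset_transversal' (ringClassSubgroup K (p ^ (e + 2)) jbar) (κ.layerSubgroup m)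
  have hΛ : ringClassSubgroup K (p ^ (e + 1)) jbar ≤ κ.layerSubgroup m := by
    rw [← he]; exact C.layer_le m
  have htAm : ∀ τ ∈ κ.layerSubgroup m, ∃! a, a ∈ A m ∧ a⁻¹ * τ ∈ ringClassSubgroup K (p ^ (e + 1)) jbar := by
    have := (hA m).2
    rwa [he] at this
  have hdist := sum_transversal_smul_eq_frobeniusTrace_smul_sub_of_le hK hH Dt hβ jbar hp hpN e
    (hx e).1 (hx (e + 1)).1 ((hx (e + 2)).1.trans (hx (e + 2)).2.1.symm) (hx (e + 2)).2.1
    (hx (e + 2)).2.2.2 hΛ (hA m).1 htAm hR htR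
  rw [← hdist]
  -- the left-hand side through `Gal(K̄/K[p^{e+2}]) ≤ Gal(K̄/K_{m+1}) ≤ Gal(K̄/K_m)`
  have hH : ringClassSubgroup K (p ^ (e + 2)) jbar ≤ κ.layerSubgroup (m + 1) := by
    rw [← hd']; exact C.layer_le (m + 1)
  have htAm1 : ∀ τ ∈ κ.layerSubgroup (m + 1),
      ∃! a, a ∈ A (m + 1) ∧ a⁻¹ * τ ∈ ringClassSubgroup K (p ^ (e + 2)) jbar := by
    have := (hA (m + 1)).2
    rwa [hd'] at this
  have hAγ : ∀ a ∈ (Finset.range p).image (fun i : ℕ ↦ γ ^ (p ^ m * i)), a ∈ κ.layerSubgroup m := by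
    intro a ha
    obtain ⟨i, -, rfl⟩ := Finset.mem_image.mp ha
    exact κ.topGenerator_pow_mem_layerSubgroup hγ m i
  rw [sum_smul_eq_sum_sum_smul hH (κ.layerSubgroup_antitone (Nat.le_succ m)) hAγ
    (κ.existsUnique_topGenerator_pow hγ m) (hA (m + 1)).1 htAm1 hR htR (hx (e + 2)).2.2.2,
    Finset.sum_image (κ.topGenerator_pow_injOn hγ m)]

end CastellaGrossiLeeSkinner2022.StabilizedHeegnerData

end Literature.NumberTheory.EllipticCurves

end
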